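import Literature.NumberTheory.EllipticCurves.SzpiroOfAbcProofs
import Literature.NumberTheory.EllipticCurves.SzpiroHallProofs
import Literature.NumberTheory.DiophantineGeometry.ConductorExponentLeEightProofs
import Literature.NumberTheory.DiophantineGeometry.ConductorExponentLeFiveProofs
import Literature.NumberTheory.DiophantineGeometry.ConductorExponentLeTwoProofs

/-!
# Crux `PolyHeightOfBoundedPrimes` (stmt-ABC-16006), line `Sketch` (idea `mordell-twist-cm-height`):
the calibration stub `stub_polyStrongHall_of_polyGenSzpiro`

The line (lead skeleton `Cruxes/PolyHeightOfBoundedPrimes/Lines/Sketch.lean`) transfers the crux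
`B′ = A → H` (`H` = polynomial height conjecture for semistable globally minimal `W/ℚ`) to
C⁺ = **polynomial strong Hall**: every primitive solution of `x³ − y² = z ≠ 0` (Bombieri–Gubler 12.5.2,
`IsPrimitiveHallSolution`: `GCD(x³, y²)` free from sixth powers) satisfies `max(|x|³, |z|) ≤ C · rad(z)^A`.
This file proves the registered CALIBRATION stub of the line, verbatim:

* `stub_polyStrongHall_of_polyGenSzpiro` — **polynomial generalized Szpiro over `ℤ`-models ⟹ C⁺**:
  if `max(|Δ(W₀)|, |c₄(W₀)|³) ≤ C · N^σ` for every `W₀ : WeierstrassCurve ℤ` which is elliptic and minimal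
  at every place of `ℤ`, then C⁺ holds with `A = 2 max(σ, 0)`. So the transfer target of the line is not
  stronger than polynomial generalized Szpiro (B–G 12.5.11 with a free exponent); with the glue stub
  `stub_polyGenSzpiro_of_polyStrongHall` (B–G Thm. 12.5.12 (b) ⟹ (c)) the two are equivalent.

Proof (the direct route (c) ⟹ (b) of B–G Thm. 12.5.12, through the curve with prescribed invariants of
Silverman AEC III.1 rather than through abc). Given a primitive `(x, y, z)`, the integral equation
`E : Y² = X³ − 27x·X − 54y` has `(c₄, c₆, Δ) = (6⁴x, 6⁶y, 2⁶3⁹z)` (`hallModel_c₄`, `hallModel_c₆`,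
`hallModel_Δ`), hence is elliptic. Take a global minimal equation `W₀` over `ℤ`, `D • (E ⊗ ℚ) = W₀ ⊗ ℚ`
(`WeierstrassCurve.exists_baseChange_int_forall_isMinimalAt`, Silverman AEC VIII.8.3), and apply the
hypothesis to `W₀`. Two estimates remain.

* SIZE (`abs_le_six_of_isPrimitive`, `natAbs_le_six_of_pow_dvd`): with `u = D.u ∈ ℚˣ` one has
  `6⁴x = u⁴ c₄(W₀)`, `6⁶y = u⁶ c₆(W₀)`, `2⁶3⁹z = u¹² Δ(W₀)`; writing `u = a/b` in lowest terms,
  `a⁴ ∣ 6⁴x` and `a⁶ ∣ 6⁶y`, and sixth-power-freeness of `GCD(x³, y²)` forces `a ∣ 6` (with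
  `g = gcd(a, 6)`, `(a/g)⁴ ∣ x`, `(a/g)⁶ ∣ y`, so `((a/g)²)⁶ ∣ GCD(x³, y²)`), i.e. `|u| ≤ 6`. Hence
  `|x| ≤ |c₄(W₀)|` and `|z| ≤ 6¹²/(2⁶3⁹) · |Δ(W₀)| = 1728 |Δ(W₀)|`. (Minimality of `W₀` is used only to
  invoke the hypothesis; the degenerate primitive solutions `x = 0` or `y = 0` need no special treatment.)
* CONDUCTOR (`conductorNorm_hallModel_dvd`): `N(W₀ ⊗ ℚ) = N(E ⊗ ℚ)` (`conductorNorm_smul_rat`) divides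
  `2⁸ · 3⁵ · rad(z)²`: `f₂ ≤ 8`, `f₃ ≤ 5`, `f_p ≤ 2` for `p ≥ 5` (the discharged facts
  `conductorExponent_le_eight_holds`, `…_le_five_of_natGenerator_eq_three_holds`,
  `…_le_two_of_five_le_natGenerator_holds`), and `f_p = 0` for `p ≥ 5`, `p ∤ z` (`p ∤ Δ(E)`, so `E` is
  minimal at `p` with good reduction: `isMinimalAt_baseChange_int_of_not_pow_dvd_Δ`,
  `conductorExponent_eq_zero_of_not_dvd_Δ`).

Then `max(|x|³, |z|) ≤ 1728 · max(|Δ(W₀)|, |c₄(W₀)|³) ≤ 1728 · C · N^σ ≤ 1728 · max(C,0) · N^{σ⁺}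
≤ 1728 · max(C,0) · (2⁸3⁵)^{σ⁺} · rad(z)^{2σ⁺}`, `σ⁺ = max(σ, 0)`, using `N ≥ 1` (`conductorNorm_pos_holds`).

Supports stmt-ABC-16006 (registered stub, name and signature verbatim; curried form
`polyStrongHall_of_polyGenSzpiro`).

References: E. Bombieri, W. Gubler, *Heights in Diophantine Geometry* (2006), 12.5.2, 12.5.9, 12.5.11,
Thm. 12.5.12 [BombieriGubler2006]; J. H. Silverman, *The Arithmetic of Elliptic Curves*, 2nd ed. (2009),
III.1, VII.1, VIII.8 [SilvermanAEC2009].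
-/

noncomputable section

-- single-conjunct summit ABC: the duplicate ABC.ABC is mandated (CONVENTIONS §2)
set_option linter.dupNamespace false

namespace Summit.ABC.ABC.Theorems.PolyHeightOfBoundedPrimes.MordellTwist

open UniqueFactorizationMonoid IsDedekindDomain Real WeierstrassCurve Rat.HeightOneSpectrum
open Literature.NumberTheory.DiophantineGeometry Literature.NumberTheory.EllipticCurves

/-! ## The integral model `Y² = X³ − 27x·X − 54y` -/

/-- The integral Weierstrass equation `Y² = X³ − 27x·X − 54y` has `c₄ = 6⁴·x` (Silverman, AEC III.1:
the equation `y² = x³ − 27c₄x − 54c₆` realises given invariants up to the scaling `(6⁴, 6⁶)`). [folklore] -/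
theorem hallModel_c₄ (x y : ℤ) :
    (⟨0, 0, 0, -27 * x, -54 * y⟩ : WeierstrassCurve ℤ).c₄ = 6 ^ 4 * x := by
  simp only [WeierstrassCurve.c₄, WeierstrassCurve.b₂, WeierstrassCurve.b₄]
  ring

/-- The integral Weierstrass equation `Y² = X³ − 27x·X − 54y` has `c₆ = 6⁶·y`. [folklore] -/
theorem hallModel_c₆ (x y : ℤ) :
    (⟨0, 0, 0, -27 * x, -54 * y⟩ : WeierstrassCurve ℤ).c₆ = 6 ^ 6 * y := by
  simp only [WeierstrassCurve.c₆, WeierstrassCurve.b₂, WeierstrassCurve.b₄, WeierstrassCurve.b₆]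
  ring

/-- The integral Weierstrass equation `Y² = X³ − 27x·X − 54y` has `Δ = 2⁶·3⁹·(x³ − y²)`
(`1728 Δ = c₄³ − c₆² = 6¹²(x³ − y²)`). [folklore] -/
theorem hallModel_Δ (x y : ℤ) :
    (⟨0, 0, 0, -27 * x, -54 * y⟩ : WeierstrassCurve ℤ).Δ = 2 ^ 6 * 3 ^ 9 * (x ^ 3 - y ^ 2) := by
  simp only [WeierstrassCurve.Δ, WeierstrassCurve.b₂, WeierstrassCurve.b₄, WeierstrassCurve.b₆,
    WeierstrassCurve.b₈]
  ring

/-! ## Primitivity bounds the scaling factor -/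

/-- **Primitivity bounds the scaling.** If `GCD(x³, y²)` is free from sixth powers (B–G 12.5.2) and an
integer `a` satisfies `a⁴ ∣ 6⁴x`, `a⁶ ∣ 6⁶y`, then `|a| ≤ 6`: with `g = gcd(a, 6)`, `a = g a'`, `6 = g b'`,
`gcd(a', b') = 1`, one gets `a'⁴ ∣ x`, `a'⁶ ∣ y`, so `(a'²)⁶ ∣ GCD(x³, y²)` and `a'² = 1`, i.e. `|a| = g ∣ 6`.
(For `p ≥ 5` this is "`p⁴ ∣ x ∧ p⁶ ∣ y` contradicts primitivity"; at `2, 3` one extra power is allowed.)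
[folklore] -/
theorem natAbs_le_six_of_pow_dvd {x y a : ℤ}
    (hprim : ∀ d : ℕ, d ^ 6 ∣ Int.gcd (x ^ 3) (y ^ 2) → d = 1)
    (h4 : a ^ 4 ∣ 6 ^ 4 * x) (h6 : a ^ 6 ∣ 6 ^ 6 * y) : a.natAbs ≤ 6 := by
  set g : ℕ := Int.gcd a 6 with hg
  have hg0 : 0 < g := Int.gcd_pos_of_ne_zero_right _ (by norm_num)
  have hg0' : (g : ℤ) ≠ 0 := by exact_mod_cast hg0.ne'
  obtain ⟨a', ha'⟩ : (g : ℤ) ∣ a := Int.gcd_dvd_left _ _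
  obtain ⟨b', hb'⟩ : (g : ℤ) ∣ 6 := Int.gcd_dvd_right _ _
  -- `a = g a'`, `6 = g b'` with `a', b'` coprime
  have hcop : IsCoprime a' b' := by
    rw [Int.isCoprime_iff_gcd_eq_one]
    have h := Int.gcd_div_gcd_div_gcd hg0
    rw [← hg] at h
    rwa [ha', hb', Int.mul_ediv_cancel_left _ hg0', Int.mul_ediv_cancel_left _ hg0'] at h
  have cancel : ∀ {c : ℤ} {n : ℕ}, a ^ n ∣ 6 ^ n * c → a' ^ n ∣ c := by
    intro c n h
    rw [ha', hb', mul_pow, mul_pow, mul_assoc] at h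
    exact hcop.pow.dvd_of_dvd_mul_left ((mul_dvd_mul_iff_left (pow_ne_zero n hg0')).mp h)
  have h4' : a' ^ 4 ∣ x := cancel h4
  have h6' : a' ^ 6 ∣ y := cancel h6
  have h12x : a'.natAbs ^ 12 ∣ (x ^ 3).natAbs := by
    rw [← Int.natAbs_pow, Int.natAbs_dvd_natAbs, show (12 : ℕ) = 4 * 3 from rfl, pow_mul]
    exact pow_dvd_pow_of_dvd h4' 3
  have h12y : a'.natAbs ^ 12 ∣ (y ^ 2).natAbs := by
    rw [← Int.natAbs_pow, Int.natAbs_dvd_natAbs, show (12 : ℕ) = 6 * 2 from rfl, pow_mul]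
    exact pow_dvd_pow_of_dvd h6' 2
  have hd : (a'.natAbs ^ 2) ^ 6 ∣ Int.gcd (x ^ 3) (y ^ 2) := by
    rw [← pow_mul, Int.gcd_eq_natAbs]
    exact Nat.dvd_gcd h12x h12y
  have h1 : a'.natAbs = 1 := by simpa using hprim _ hd
  have hag : a.natAbs = g := by rw [ha', Int.natAbs_mul, Int.natAbs_natCast, h1, mul_one]
  rw [hag]
  exact Int.gcd_le_natAbs_right a (by norm_num)

/-- **The scaling factor of a primitive solution is at most `6`.** If `GCD(x³, y²)` is free from sixth
powers and a rational `u` satisfies `6⁴x = u⁴c₄`, `6⁶y = u⁶c₆` with integers `c₄, c₆` (the covariants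
of an integral model `ℚ`-isomorphic to `Y² = X³ − 27x·X − 54y`, `u` the scaling of the isomorphism), then
`|u| ≤ 6`: writing `u = a/b` in lowest terms, `a⁴ ∣ 6⁴x` and `a⁶ ∣ 6⁶y`, so `|a| ≤ 6` by
`natAbs_le_six_of_pow_dvd`, and `|u| = |a|/b ≤ |a|`. [folklore] -/
theorem abs_le_six_of_isPrimitive {x y : ℤ}
    (hprim : ∀ d : ℕ, d ^ 6 ∣ Int.gcd (x ^ 3) (y ^ 2) → d = 1) {u : ℚ}
    {c₄ c₆ : ℤ} (h4 : ((6 ^ 4 * x : ℤ) : ℚ) = u ^ 4 * c₄)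
    (h6 : ((6 ^ 6 * y : ℤ) : ℚ) = u ^ 6 * c₆) : |u| ≤ 6 := by
  set a : ℤ := u.num with ha
  set b : ℕ := u.den with hb
  have hb0 : (b : ℚ) ≠ 0 := by exact_mod_cast u.den_nz
  have hab : u = a / b := (Rat.num_div_den u).symm
  have hcop : IsCoprime a (b : ℤ) := Rat.isCoprime_num_den u
  -- clear denominators
  have e4 : 6 ^ 4 * x * (b : ℤ) ^ 4 = a ^ 4 * c₄ := by
    have h : ((6 ^ 4 * x : ℤ) : ℚ) * (b : ℚ) ^ 4 = (a : ℚ) ^ 4 * c₄ := by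
      rw [h4, hab]; field_simp
    exact_mod_cast h
  have e6 : 6 ^ 6 * y * (b : ℤ) ^ 6 = a ^ 6 * c₆ := by
    have h : ((6 ^ 6 * y : ℤ) : ℚ) * (b : ℚ) ^ 6 = (a : ℚ) ^ 6 * c₆ := by
      rw [h6, hab]; field_simp
    exact_mod_cast h
  have d4 : a ^ 4 ∣ 6 ^ 4 * x := hcop.pow.dvd_of_dvd_mul_right ⟨c₄, e4⟩
  have d6 : a ^ 6 ∣ 6 ^ 6 * y := hcop.pow.dvd_of_dvd_mul_right ⟨c₆, e6⟩
  have hle := natAbs_le_six_of_pow_dvd hprim d4 d6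
  have hb1 : (1 : ℚ) ≤ b := by exact_mod_cast u.den_pos
  rw [hab, abs_div, Nat.abs_cast]
  calc |(a : ℚ)| / b ≤ |(a : ℚ)| := div_le_self (abs_nonneg _) hb1
    _ = (a.natAbs : ℚ) := by rw [Nat.cast_natAbs, Int.cast_abs]
    _ ≤ 6 := by exact_mod_cast hle

/-! ## The conductor of the model -/

/-- **Conductor of `Y² = X³ − 27x·X − 54y`.** For `z = x³ − y² ≠ 0` the conductor of the curve divides
`2⁸·3⁵·rad(z)²`: `f₂ ≤ 8`, `f₃ ≤ 5` (`conductorExponent_le_eight_holds`,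
`conductorExponent_le_five_of_natGenerator_eq_three_holds`; Brumer–Kramer / Silverman ATAEC IV.10.4),
`f_p ≤ 2` for `p ≥ 5` (`conductorExponent_le_two_of_five_le_natGenerator_holds`), and `f_p = 0` for
`p ≥ 5`, `p ∤ z`, since then `p ∤ Δ = 2⁶3⁹z`, so the equation is minimal at `p` with good reduction
(`isMinimalAt_baseChange_int_of_not_pow_dvd_Δ`, `conductorExponent_eq_zero_of_not_dvd_Δ`; B–G 12.5.9(a)).
[cite: BombieriGubler2006, 12.5.9] -/
theorem conductorNorm_hallModel_dvd {x y : ℤ} (hz : x ^ 3 - y ^ 2 ≠ 0) :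
    ((⟨0, 0, 0, -27 * x, -54 * y⟩ : WeierstrassCurve ℤ).baseChange ℚ).conductorNorm ℤ ∣
      2 ^ 8 * 3 ^ 5 * radical (x ^ 3 - y ^ 2).natAbs ^ 2 := by
  set E : WeierstrassCurve ℤ := ⟨0, 0, 0, -27 * x, -54 * y⟩ with hE
  set m : ℤ := x ^ 3 - y ^ 2 with hm
  have hΔ : E.Δ = 2 ^ 6 * 3 ^ 9 * m := hallModel_Δ x y
  have hΔ0 : E.Δ ≠ 0 := by rw [hΔ]; exact mul_ne_zero (by norm_num) hz
  haveI := isElliptic_baseChange_int E hΔ0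
  have hm0 : m.natAbs ≠ 0 := Int.natAbs_ne_zero.mpr hz
  have hr0 : radical m.natAbs ^ 2 ≠ 0 := pow_ne_zero _ radical_ne_zero
  refine conductorNorm_dvd_of_forall_conductorExponent_le _
    (mul_ne_zero (by norm_num) hr0) fun p ↦ ?_
  obtain ⟨p, hp⟩ := p
  set v : HeightOneSpectrum ℤ := (primesEquiv (R := ℤ)).symm ⟨p, hp⟩ with hv
  have hgen : natGenerator v = p :=
    Literature.NumberTheory.EllipticCurves.Rat.natGenerator_primesEquiv_symm ⟨p, hp⟩
  simp only
  rw [Nat.factorization_mul (by norm_num) hr0,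
    Nat.factorization_mul (by norm_num) (by norm_num), Nat.Prime.factorization_pow Nat.prime_two,
    Nat.Prime.factorization_pow Nat.prime_three, Nat.factorization_pow, Finsupp.add_apply,
    Finsupp.add_apply, Finsupp.smul_apply, smul_eq_mul, Finsupp.single_apply, Finsupp.single_apply,
    factorization_radical_apply hm0 hp]
  by_cases h2 : p = 2
  · subst h2
    have h8 : (E.baseChange ℚ).conductorExponent v ≤ 8 := conductorExponent_le_eight_holds _ v
    split_ifs <;> omega
  by_cases h3 : p = 3
  · subst h3
    have h5 : (E.baseChange ℚ).conductorExponent v ≤ 5 :=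
      conductorExponent_le_five_of_natGenerator_eq_three_holds _ v hgen
    split_ifs <;> omega
  have h5 : 5 ≤ p := hp.five_le_of_ne_two_of_ne_three h2 h3
  rw [if_neg (Ne.symm h2), if_neg (Ne.symm h3), zero_add, zero_add]
  by_cases hpm : p ∣ m.natAbs
  · rw [if_pos hpm]
    have h2' : (E.baseChange ℚ).conductorExponent v ≤ 2 :=
      conductorExponent_le_two_of_five_le_natGenerator_holds _ v (hgen ▸ h5)
    omega
  · rw [if_neg hpm, mul_zero, Nat.le_zero]
    have hpΔ : ¬ (p : ℤ) ∣ E.Δ := by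
      rw [hΔ]
      intro h
      rcases Int.Prime.dvd_mul hp h with h' | h'
      · exact absurd h' (by simpa using not_dvd_two_pow_mul_three_pow hp h5 6 9)
      · exact hpm h'
    have hmin : (E.baseChange ℚ).IsMinimalAt v := by
      refine isMinimalAt_baseChange_int_of_not_pow_dvd_Δ ?_
      rw [hgen]
      exact fun h ↦ hpΔ (dvd_trans (dvd_pow_self _ (by norm_num)) h)
    exact conductorExponent_eq_zero_of_not_dvd_Δ hmin (by rw [hgen]; exact hpΔ)

/-! ## The registered stub -/

/-- **Registered stub `stub_polyStrongHall_of_polyGenSzpiro` (calibration of line `Sketch`).** Polynomial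
generalized Szpiro over `ℤ`-models minimal at every place (`max(|Δ|, |c₄|³) ≤ C·N^σ`) implies polynomial
strong Hall with exponent `A = 2·max(σ, 0)` and constant `1728 · max(C, 0) · (2⁸3⁵)^{max(σ,0)}`: for a
primitive solution of `x³ − y² = z ≠ 0` (B–G 12.5.2) take the integral curve `E : Y² = X³ − 27x·X − 54y`,
`(c₄, c₆, Δ)(E) = (6⁴x, 6⁶y, 2⁶3⁹z)` (`hallModel_c₄/_c₆/_Δ`), and a global minimal equation `W₀` over
`ℤ` with `D • (E ⊗ ℚ) = W₀ ⊗ ℚ` (`exists_baseChange_int_forall_isMinimalAt`, Silverman AEC VIII.8.3);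
with `u = D.u`, `6⁴x = u⁴c₄(W₀)`, `6⁶y = u⁶c₆(W₀)`, `2⁶3⁹z = u¹²Δ(W₀)` (Mathlib `variableChange_c₄/_c₆/_Δ`),
and primitivity gives `|u| ≤ 6` (`abs_le_six_of_isPrimitive`), whence `|x| ≤ |c₄(W₀)|`,
`|z| ≤ 1728·|Δ(W₀)|`; the hypothesis bounds `max(|Δ(W₀)|, |c₄(W₀)|³)` by `C·N^σ`, where
`N = N(E ⊗ ℚ)` (`conductorNorm_smul_rat`) divides `2⁸3⁵·rad(z)²` (`conductorNorm_hallModel_dvd`), and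
`N^σ ≤ N^{max(σ,0)} ≤ (2⁸3⁵)^{max(σ,0)}·rad(z)^{2 max(σ,0)}` as `N ≥ 1` (`conductorNorm_pos_holds`). This is
the direct form of Bombieri–Gubler, Thm. 12.5.12, (c) ⟹ (b), with free exponents; together with
`stub_polyGenSzpiro_of_polyStrongHall` it shows that the transfer target C⁺ of the line is EQUIVALENT to
polynomial generalized Szpiro over `ℤ`-models. [cite: BombieriGubler2006, Thm. 12.5.12] -/
theorem stub_polyStrongHall_of_polyGenSzpiro :
    (∃ σ C : ℝ, ∀ W₀ : WeierstrassCurve ℤ, (W₀.baseChange ℚ).IsElliptic →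
      (∀ v : HeightOneSpectrum ℤ, (W₀.baseChange ℚ).IsMinimalAt v) →
      ((max |W₀.Δ| (|W₀.c₄| ^ 3) : ℤ) : ℝ) ≤ C * ((W₀.baseChange ℚ).conductorNorm ℤ : ℝ) ^ σ) →
    ∃ A C : ℝ, ∀ x y z : ℤ, IsPrimitiveHallSolution x y z →
      ((max (|x| ^ 3) |z| : ℤ) : ℝ) ≤ C * ((radical z.natAbs : ℕ) : ℝ) ^ A := by
  rintro ⟨σ, C, hC⟩
  refine ⟨2 * max σ 0, 1728 * max C 0 * (2 ^ 8 * 3 ^ 5) ^ max σ 0, fun x y z hsol ↦ ?_⟩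
  obtain ⟨hxyz, hz, hprim⟩ := hsol
  have hz' : x ^ 3 - y ^ 2 ≠ 0 := by rwa [hxyz]
  -- the integral model `Y² = X³ − 27x X − 54y` with `(c₄, c₆, Δ) = (6⁴x, 6⁶y, 2⁶3⁹z)`
  set E : WeierstrassCurve ℤ := ⟨0, 0, 0, -27 * x, -54 * y⟩ with hE
  have hEc₄ : E.c₄ = 6 ^ 4 * x := hallModel_c₄ x y
  have hEc₆ : E.c₆ = 6 ^ 6 * y := hallModel_c₆ x y
  have hEΔ : E.Δ = 2 ^ 6 * 3 ^ 9 * z := by rw [hallModel_Δ, hxyz]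
  have hΔ0 : E.Δ ≠ 0 := by rw [hEΔ]; exact mul_ne_zero (by norm_num) hz
  haveI hell : (E.baseChange ℚ).IsElliptic := isElliptic_baseChange_int E hΔ0
  -- a global minimal equation `W₀` over `ℤ`, `D • (E ⊗ ℚ) = W₀ ⊗ ℚ`
  obtain ⟨D, W₀, hDW, hmin⟩ := exists_baseChange_int_forall_isMinimalAt (E.baseChange ℚ)
  have hΔ0' : W₀.Δ ≠ 0 := by
    intro h0
    have h1 : (D • E.baseChange ℚ).Δ = 0 := by rw [hDW, baseChange_int_Δ, h0, Int.cast_zero]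
    exact (D • E.baseChange ℚ).isUnit_Δ.ne_zero h1
  have hell' : (W₀.baseChange ℚ).IsElliptic := isElliptic_baseChange_int W₀ hΔ0'
  -- the hypothesis on `W₀`
  have key := hC W₀ hell' hmin
  -- the conductor: `N(W₀ ⊗ ℚ) = N(E ⊗ ℚ) ∣ 2⁸ 3⁵ rad(z)²`
  set N : ℕ := (W₀.baseChange ℚ).conductorNorm ℤ with hNdef
  set R : ℕ := radical z.natAbs with hRdef
  have hN1 : (1 : ℝ) ≤ N := by
    rw [hNdef]; exact_mod_cast conductorNorm_pos_holds (W₀.baseChange ℚ)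
  have hNle : (N : ℝ) ≤ 2 ^ 8 * 3 ^ 5 * (R : ℝ) ^ 2 := by
    have hdvd : (E.baseChange ℚ).conductorNorm ℤ ∣ 2 ^ 8 * 3 ^ 5 * radical z.natAbs ^ 2 := by
      have h := conductorNorm_hallModel_dvd (x := x) (y := y) hz'
      rwa [hxyz] at h
    rw [← conductorNorm_smul_rat (E.baseChange ℚ) D, hDW] at hdvd
    rw [hNdef, hRdef]
    exact_mod_cast Nat.le_of_dvd (by positivity) hdvd
  -- the scaling `u = D.u`: `6⁴ x = u⁴ c₄(W₀)`, `6⁶ y = u⁶ c₆(W₀)`, `2⁶ 3⁹ z = u¹² Δ(W₀)`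
  set u : ℚ := (D.u : ℚ) with hu
  have hu0 : u ≠ 0 := D.u.ne_zero
  have r4 : ((6 ^ 4 * x : ℤ) : ℚ) = u ^ 4 * W₀.c₄ := by
    have h := congrArg WeierstrassCurve.c₄ hDW
    rw [variableChange_c₄, baseChange_int_c₄, baseChange_int_c₄, hEc₄, Units.val_inv_eq_inv_val,
      ← hu] at h
    rw [← h]; field_simp
  have r6 : ((6 ^ 6 * y : ℤ) : ℚ) = u ^ 6 * W₀.c₆ := by
    have h := congrArg WeierstrassCurve.c₆ hDW
    rw [variableChange_c₆, baseChange_int_c₆, baseChange_int_c₆, hEc₆, Units.val_inv_eq_inv_val,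
      ← hu] at h
    rw [← h]; field_simp
  have r12 : ((2 ^ 6 * 3 ^ 9 * z : ℤ) : ℚ) = u ^ 12 * W₀.Δ := by
    have h := congrArg WeierstrassCurve.Δ hDW
    rw [variableChange_Δ, baseChange_int_Δ, baseChange_int_Δ, hEΔ, Units.val_inv_eq_inv_val,
      ← hu] at h
    rw [← h]; field_simp
  -- primitivity: `|u| ≤ 6`
  have hu6 : |u| ≤ 6 := abs_le_six_of_isPrimitive hprim r4 r6
  -- size: `|x| ≤ |c₄(W₀)|`, `|z| ≤ 1728 |Δ(W₀)|`
  have hx : |(x : ℝ)| ≤ |(W₀.c₄ : ℝ)| := by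
    have hq : |(x : ℚ)| ≤ |(W₀.c₄ : ℚ)| := by
      have h1 : (6 : ℚ) ^ 4 * |(x : ℚ)| = |u| ^ 4 * |(W₀.c₄ : ℚ)| := by
        rw [← abs_pow, ← abs_mul, ← r4]; push_cast; simp only [abs_mul]; norm_num
      have h2 : |u| ^ 4 ≤ 6 ^ 4 := pow_le_pow_left₀ (abs_nonneg u) hu6 4
      nlinarith [abs_nonneg (x : ℚ), abs_nonneg (W₀.c₄ : ℚ)]
    have h := (Rat.cast_le (K := ℝ)).mpr hq
    simpa only [Rat.cast_abs, Rat.cast_intCast] using h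
  have hzle : |(z : ℝ)| ≤ 1728 * |(W₀.Δ : ℝ)| := by
    have hq : |(z : ℚ)| ≤ 1728 * |(W₀.Δ : ℚ)| := by
      have h1 : (2 : ℚ) ^ 6 * 3 ^ 9 * |(z : ℚ)| = |u| ^ 12 * |(W₀.Δ : ℚ)| := by
        rw [← abs_pow, ← abs_mul, ← r12]; push_cast; simp only [abs_mul]; norm_num
      have h2 : |u| ^ 12 ≤ 6 ^ 12 := pow_le_pow_left₀ (abs_nonneg u) hu6 12
      nlinarith [abs_nonneg (z : ℚ), abs_nonneg (W₀.Δ : ℚ)]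
    have h := (Rat.cast_le (K := ℝ)).mpr hq
    simpa only [Rat.cast_abs, Rat.cast_intCast, Rat.cast_mul, Rat.cast_ofNat] using h
  -- real bookkeeping
  have hσ0 : 0 ≤ max σ 0 := le_max_right _ _
  have hC0 : 0 ≤ max C 0 := le_max_right _ _
  have hR0 : (0 : ℝ) ≤ R := by positivity
  have hmax : ((max |W₀.Δ| (|W₀.c₄| ^ 3) : ℤ) : ℝ) = max |(W₀.Δ : ℝ)| (|(W₀.c₄ : ℝ)| ^ 3) := by
    push_cast; rfl
  have key' : max |(W₀.Δ : ℝ)| (|(W₀.c₄ : ℝ)| ^ 3) ≤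
      max C 0 * (2 ^ 8 * 3 ^ 5) ^ max σ 0 * (R : ℝ) ^ (2 * max σ 0) := by
    rw [← hmax]
    calc _ ≤ C * (N : ℝ) ^ σ := key
      _ ≤ max C 0 * (N : ℝ) ^ σ := mul_le_mul_of_nonneg_right (le_max_left _ _) (by positivity)
      _ ≤ max C 0 * (N : ℝ) ^ max σ 0 :=
        mul_le_mul_of_nonneg_left (Real.rpow_le_rpow_of_exponent_le hN1 (le_max_left _ _)) hC0
      _ ≤ max C 0 * (2 ^ 8 * 3 ^ 5 * (R : ℝ) ^ 2) ^ max σ 0 :=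
        mul_le_mul_of_nonneg_left (Real.rpow_le_rpow (by positivity) hNle hσ0) hC0
      _ = max C 0 * (2 ^ 8 * 3 ^ 5) ^ max σ 0 * (R : ℝ) ^ (2 * max σ 0) := by
        rw [Real.mul_rpow (by norm_num) (by positivity), Real.rpow_mul hR0, Real.rpow_two]
        ring
  have hK : 0 ≤ max C 0 * (2 ^ 8 * 3 ^ 5) ^ max σ 0 * (R : ℝ) ^ (2 * max σ 0) := by positivity
  rw [Int.cast_max, Int.cast_pow, Int.cast_abs, Int.cast_abs]
  refine max_le ?_ ?_
  · calc |(x : ℝ)| ^ 3 ≤ |(W₀.c₄ : ℝ)| ^ 3 := pow_le_pow_left₀ (abs_nonneg _) hx 3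
      _ ≤ max |(W₀.Δ : ℝ)| (|(W₀.c₄ : ℝ)| ^ 3) := le_max_right _ _
      _ ≤ max C 0 * (2 ^ 8 * 3 ^ 5) ^ max σ 0 * (R : ℝ) ^ (2 * max σ 0) := key'
      _ ≤ 1728 * max C 0 * (2 ^ 8 * 3 ^ 5) ^ max σ 0 * (R : ℝ) ^ (2 * max σ 0) := by
        nlinarith
  · calc |(z : ℝ)| ≤ 1728 * |(W₀.Δ : ℝ)| := hzle
      _ ≤ 1728 * max |(W₀.Δ : ℝ)| (|(W₀.c₄ : ℝ)| ^ 3) := by gcongr; exact le_max_left _ _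
      _ ≤ 1728 * (max C 0 * (2 ^ 8 * 3 ^ 5) ^ max σ 0 * (R : ℝ) ^ (2 * max σ 0)) := by gcongr
      _ = 1728 * max C 0 * (2 ^ 8 * 3 ^ 5) ^ max σ 0 * (R : ℝ) ^ (2 * max σ 0) := by ring

/-- Curried form of `stub_polyStrongHall_of_polyGenSzpiro`: polynomial generalized Szpiro over `ℤ`-models
minimal at every place implies polynomial strong Hall. [cite: BombieriGubler2006, Thm. 12.5.12] -/
theorem polyStrongHall_of_polyGenSzpiro
    (h : ∃ σ C : ℝ, ∀ W₀ : WeierstrassCurve ℤ, (W₀.baseChange ℚ).IsElliptic →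
      (∀ v : HeightOneSpectrum ℤ, (W₀.baseChange ℚ).IsMinimalAt v) →
      ((max |W₀.Δ| (|W₀.c₄| ^ 3) : ℤ) : ℝ) ≤ C * ((W₀.baseChange ℚ).conductorNorm ℤ : ℝ) ^ σ) :
    ∃ A C : ℝ, ∀ x y z : ℤ, IsPrimitiveHallSolution x y z →
      ((max (|x| ^ 3) |z| : ℤ) : ℝ) ≤ C * ((radical z.natAbs : ℕ) : ℝ) ^ A :=
  stub_polyStrongHall_of_polyGenSzpiro h

end Summit.ABC.ABC.Theorems.PolyHeightOfBoundedPrimes.MordellTwist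

end
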